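import Literature.NumberTheory.EllipticCurves.SerreOpenImageDeterminantProofs
import Literature.NumberTheory.EllipticCurves.SerreOpenImageLemmeTroisProofs
import Literature.NumberTheory.GaloisRepresentations.SerreOpenImageGroupLemmas
import HarnessLib

/-!
# Serre 1972, §4.2 b)–c) over `ℚ`: reduction of the open image theorem to the normaliser case

Topic `NumberTheory/EllipticCurves`.  Theorems only (nothing is defined, no named fact).  For an
elliptic curve `E = W/ℚ`, a prime `ℓ` and a frame `(e, Φ)` of `E[ℓ]`
(`exists_frame_galoisRepTorsion_rat`, `SerreOpenImageDeterminantProofs`), write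
`G_ℓ = Φ(ρ̄_{E,ℓ}(Γ_ℚ)) ⊆ GL₂(𝔽_ℓ)` (`(galoisRepTorsion W ℓ).range.map Φ`).  This file assembles
step b) of the proof of J.-P. Serre, *Propriétés galoisiennes des points d'ordre fini des courbes
elliptiques*, Invent. Math. 15 (1972), §4.2, Théorème 2 (the tree's named fact
`Literature.NumberTheory.EllipticCurves.serre_open_image`) over `K = ℚ`, in the sharpened form of
§5.4 (proof of Prop. 21 i)) which uses §5.2 (iii)–(iv):

* `WeierstrassCurve.map_range_galoisRepTorsion_eq_top_iff` — `G_ℓ = GL₂(𝔽_ℓ)` iff `ρ̄_{E,ℓ}` is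
  onto (`HasSurjectiveModNGaloisRep`);
* `WeierstrassCurve.exists_mem_map_range_det_eq`, `WeierstrassCurve.exists_conj_mem_map_range` —
  §5.2 (iii)–(iv) for `G_ℓ`: `det G_ℓ = 𝔽_ℓˣ`, and `G_ℓ ∋ c` with `c² = 1`, `det c = -1`;
* `WeierstrassCurve.not_le_eigenvectorStabilizer_of_hasIrreducibleModPGaloisRep` — if `E[ℓ]` is
  irreducible, `G_ℓ` lies in no Borel subgroup;
* `WeierstrassCurve.exists_cartan_normalizer_of_not_hasSurjectiveModNGaloisRep` — **§4.2 b) over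
  `ℚ`**: for `ℓ ≠ 2, 5`, if `G_ℓ` contains a split half-Cartan subgroup or a non-split Cartan
  subgroup (the local input of §1.11 at `ℓ`), `E[ℓ]` is irreducible (for `ℓ` large this is the
  tree's theorem `finite_setOf_not_hasIrreducibleModPGaloisRep_rat`) and `ρ̄_{E,ℓ}` is not onto,
  then `G_ℓ ⊆ N(C)`, `G_ℓ ⊄ C` for a Cartan subgroup `C` — case ii) of §4.2 b), cases i) being
  excluded;
* the quadratic character of case ii) as a subgroup `U = ρ̄⁻¹(Φ⁻¹(C)) ≤ Γ_ℚ` ("`Gal(K̄/K'_l)`"):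
  `WeierstrassCurve.index_comap_cartan_eq_two` (`[Γ_ℚ : U] = 2`, from `(N : C) = 2`),
  `WeierstrassCurve.isOpen_comap_cartan` (`U` is open), `WeierstrassCurve.inertia_le_comap_cartan`
  (**Lemme 2 at the good places `v ∤ l`**: `U` contains the inertia groups above every good
  `p ≠ ℓ`, `E[ℓ]` being unramified there), and the link with Lemme 3
  (`SerreOpenImageLemmeTroisProofs`):
  `WeierstrassCurve.natCast_dvd_frobeniusTrace_of_not_mem_comap_cartan` — a Frobenius at a good
  `p ≠ ℓ` outside `U` ("`v` inerte dans `K'_l`") forces `ℓ ∣ a_p`.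

What is *not* here: the local input itself (§1.11: the image of an inertia group at `ℓ`
contains a split half-Cartan or a non-split Cartan subgroup, and lies in `C` in case ii) —
Lemme 2 at `v ∣ l`), the finiteness of the possible `U` (quadratic fields unramified outside the
bad primes), and the density argument concluding step c).

## References

* [Serre1972] J.-P. Serre, Invent. Math. 15 (1972) 259–331: §4.2 b), c) (Lemme 2, Lemme 3);
  §5.2 (iii)–(iv); §5.4, proof of Prop. 21 i).
-/

noncomputable section

open scoped Classical NumberField
open IsDedekindDomain Field Matrix

namespace WeierstrassCurve

open Literature.NumberTheory.EllipticCurves Literature.NumberTheory.GaloisRepresentations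
  Literature.NumberTheory.GaloisRepresentations.Serre1972 NumberField Rat.HeightOneSpectrum

variable (W : WeierstrassCurve ℚ) (ℓ : ℕ) [Fact ℓ.Prime]
  (Φ : Multiplicative (AddAut (geomTorsion W ℓ)) ≃* GL (Fin 2) (ZMod ℓ))

/-! ### The image `G_ℓ = Φ(ρ̄_{E,ℓ}(Γ_ℚ))` -/

/-- Membership in `G_ℓ = Φ(ρ̄_{E,ℓ}(Γ_ℚ))`. [folklore] -/
theorem mem_map_range_galoisRepTorsion_iff {g : GL (Fin 2) (ZMod ℓ)} :
    g ∈ (galoisRepTorsion W ℓ).range.map Φ.toMonoidHom ↔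
      ∃ σ : absoluteGaloisGroup ℚ, Φ (galoisRepTorsion W ℓ σ) = g := by
  constructor
  · rintro ⟨x, ⟨σ, rfl⟩, rfl⟩
    exact ⟨σ, rfl⟩
  · rintro ⟨σ, rfl⟩
    exact ⟨galoisRepTorsion W ℓ σ, ⟨σ, rfl⟩, rfl⟩

/-- `Φ(ρ̄ σ) ∈ G_ℓ`. [folklore] -/
theorem apply_galoisRepTorsion_mem_map_range (σ : absoluteGaloisGroup ℚ) :
    Φ (galoisRepTorsion W ℓ σ) ∈ (galoisRepTorsion W ℓ).range.map Φ.toMonoidHom :=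
  (mem_map_range_galoisRepTorsion_iff W ℓ Φ).mpr ⟨σ, rfl⟩

/-- **`G_ℓ = GL₂(𝔽_ℓ)` iff `ρ̄_{E,ℓ} : Γ_ℚ → Aut(E[ℓ])` is onto** ("`φ_l(G) = Aut(E_l)`",
§4.1–4.2). [cite: Serre1972, §4.2, Théorème 2] -/
theorem map_range_galoisRepTorsion_eq_top_iff :
    (galoisRepTorsion W ℓ).range.map Φ.toMonoidHom = ⊤ ↔ W.HasSurjectiveModNGaloisRep ℓ := by
  rw [HasSurjectiveModNGaloisRep, ← MonoidHom.range_eq_top, Subgroup.eq_top_iff',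
    Subgroup.eq_top_iff']
  constructor
  · intro h x
    obtain ⟨σ, hσ⟩ := (mem_map_range_galoisRepTorsion_iff W ℓ Φ).mp (h (Φ x))
    exact ⟨σ, Φ.injective hσ⟩
  · intro h g
    obtain ⟨σ, hσ⟩ := h (Φ.symm g)
    exact (mem_map_range_galoisRepTorsion_iff W ℓ Φ).mpr ⟨σ, by rw [hσ, MulEquiv.apply_symm_apply]⟩

section Frame

variable (e : geomTorsion W ℓ ≃+ (Fin 2 → ZMod ℓ))
  (he : ∀ (g : Multiplicative (AddAut (geomTorsion W ℓ))) (x : geomTorsion W ℓ),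
    e (Multiplicative.toAdd g x) =
      ((Φ g : GL (Fin 2) (ZMod ℓ)) : Matrix (Fin 2) (Fin 2) (ZMod ℓ)) *ᵥ e x)

include he

/-- **§5.2 (iii) for `G_ℓ`: `det : G_ℓ → 𝔽_ℓˣ` is onto** (`det Φ(ρ̄ σ) = χ̄_ℓ(σ)` and `χ̄_ℓ` is
onto over `ℚ`). [cite: Serre1972, §5.2 (iii)] -/
theorem exists_mem_map_range_det_eq [W.IsElliptic] (u : (ZMod ℓ)ˣ) :
    ∃ g ∈ (galoisRepTorsion W ℓ).range.map Φ.toMonoidHom, Matrix.GeneralLinearGroup.det g = u := by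
  haveI : NeZero ℓ := ⟨(Fact.out : ℓ.Prime).ne_zero⟩
  obtain ⟨σ, hσ⟩ := modPCyclotomicCharacterZMod_rat_surjective ℓ u
  exact ⟨_, apply_galoisRepTorsion_mem_map_range W ℓ Φ σ, by
    rw [det_frame_galoisRepTorsion_eq' W ℓ e Φ he σ, hσ]⟩

/-- **§5.2 (iv) for `G_ℓ`: complex conjugation** — `G_ℓ` contains an element `c` with `c² = 1`
and `det c = -1`. [cite: Serre1972, §5.2 (iv)] -/
theorem exists_conj_mem_map_range [W.IsElliptic] :
    ∃ c ∈ (galoisRepTorsion W ℓ).range.map Φ.toMonoidHom, c * c = 1 ∧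
      Matrix.det ((c : GL (Fin 2) (ZMod ℓ)) : Matrix (Fin 2) (Fin 2) (ZMod ℓ)) = -1 := by
  haveI : NeZero ℓ := ⟨(Fact.out : ℓ.Prime).ne_zero⟩
  obtain ⟨c, hc2, hcχ⟩ := exists_sq_eq_one_modPCyclotomicCharacterZMod_eq_neg_one ℓ
  refine ⟨_, apply_galoisRepTorsion_mem_map_range W ℓ Φ c, ?_, ?_⟩
  · rw [← map_mul, ← map_mul, ← sq, hc2, map_one, map_one]
  · rw [det_frame_galoisRepTorsion_eq W ℓ e Φ he c, hcχ]

/-- **`E[ℓ]` irreducible ⇒ `G_ℓ` lies in no Borel subgroup.**  If every `Φ(ρ̄ σ)` has the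
non-zero vector `v` as an eigenvector, the line `e⁻¹(𝔽_ℓ v) ⊆ E[ℓ]` is a `Γ_ℚ`-stable subgroup
other than `O` and `E[ℓ]` ("`φ_l(G)` est contenu dans un sous-groupe de Borel" means `E_l` is
reducible, §4.2 b) i) / §5.4). [cite: Serre1972, §4.2 b) i)] -/
theorem not_le_eigenvectorStabilizer_of_hasIrreducibleModPGaloisRep
    (hirr : W.HasIrreducibleModPGaloisRep ℓ) {v : Fin 2 → ZMod ℓ} (hv : v ≠ 0) :
    ¬ (galoisRepTorsion W ℓ).range.map Φ.toMonoidHom ≤ eigenvectorStabilizer v hv := by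
  intro hle
  -- the line `e⁻¹(𝔽_ℓ v)`
  let H : AddSubgroup (geomTorsion W ℓ) :=
    { carrier := {P | ∃ a : ZMod ℓ, e P = a • v}
      zero_mem' := ⟨0, by rw [map_zero, zero_smul]⟩
      add_mem' := by
        rintro P Q ⟨a, ha⟩ ⟨b, hb⟩
        exact ⟨a + b, by rw [map_add, ha, hb, add_smul]⟩
      neg_mem' := by
        rintro P ⟨a, ha⟩
        exact ⟨-a, by rw [map_neg, ha, neg_smul]⟩ }
  have hmem : ∀ P : geomTorsion W ℓ, P ∈ H ↔ ∃ a : ZMod ℓ, e P = a • v := fun P ↦ Iff.rfl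
  -- `H` is `Γ_ℚ`-stable
  have hstab : ∀ σ : absoluteGaloisGroup ℚ, ∀ P ∈ H, σ • P ∈ H := by
    intro σ P hP
    obtain ⟨a, ha⟩ := (hmem P).mp hP
    obtain ⟨b, hb⟩ := mem_eigenvectorStabilizer_iff.mp
      (hle (apply_galoisRepTorsion_mem_map_range W ℓ Φ σ))
    refine (hmem _).mpr ⟨a * b, ?_⟩
    have h1 : σ • P = Multiplicative.toAdd (galoisRepTorsion W ℓ σ) P := rfl
    rw [h1, he, ha, Matrix.mulVec_smul, hb, smul_smul]
  rcases hirr H hstab with hbot | htop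
  · -- `e⁻¹ v ∈ H` is non-zero
    have hvH : e.symm v ∈ H := (hmem _).mpr ⟨1, by rw [AddEquiv.apply_symm_apply, one_smul]⟩
    rw [hbot, AddSubgroup.mem_bot, AddEquiv.symm_apply_eq, map_zero] at hvH
    exact hv hvH
  · -- a vector off the line is not in `H`
    obtain ⟨w, hw⟩ := exists_det_cols_ne_zero hv
    have hwH : e.symm w ∈ H := htop ▸ AddSubgroup.mem_top _
    obtain ⟨a, ha⟩ := (hmem _).mp hwH
    rw [AddEquiv.apply_symm_apply] at ha
    apply hw
    rw [ha]
    simp only [Pi.smul_apply, smul_eq_mul]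
    ring

/-- **Serre 1972, §4.2 b) over `ℚ` (with §5.2 (iii)–(iv), as in §5.4).**  Let `ℓ ≠ 2, 5`, and
suppose that `G_ℓ = Φ(ρ̄_{E,ℓ}(Γ_ℚ))` contains a split half-Cartan subgroup or a non-split Cartan
subgroup of `GL₂(𝔽_ℓ)` (the local input at `ℓ`: §1.11, Cor. to Prop. 11 and Prop. 12 c)), that
`E[ℓ]` is irreducible and that `ρ̄_{E,ℓ}` is not onto.  Then `G_ℓ` is contained in the
normaliser `N` of a Cartan subgroup `C` and not in `C` (case ii); case i) "Borel or Cartan" is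
excluded by irreducibility and complex conjugation).
[cite: Serre1972, §4.2 b); §5.4, proof of Prop. 21 i)] -/
theorem exists_cartan_normalizer_of_not_hasSurjectiveModNGaloisRep [W.IsElliptic] (hℓ2 : ℓ ≠ 2)
    (hℓ5 : ℓ ≠ 5)
    (hloc : (∃ P : GL (Fin 2) (ZMod ℓ),
        halfSplitCartan P ≤ (galoisRepTorsion W ℓ).range.map Φ.toMonoidHom) ∨
      ∃ k : Subalgebra (ZMod ℓ) (Matrix (Fin 2) (Fin 2) (ZMod ℓ)), IsField k ∧
        Module.finrank (ZMod ℓ) k = 2 ∧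
          unitGroup k ≤ (galoisRepTorsion W ℓ).range.map Φ.toMonoidHom)
    (hirr : W.HasIrreducibleModPGaloisRep ℓ) (hns : ¬ W.HasSurjectiveModNGaloisRep ℓ) :
    ∃ C ∈ cartanSubgroups (ZMod ℓ),
      (galoisRepTorsion W ℓ).range.map Φ.toMonoidHom ≤
          Subgroup.normalizer (C : Set (GL (Fin 2) (ZMod ℓ))) ∧
        ¬ (galoisRepTorsion W ℓ).range.map Φ.toMonoidHom ≤ C := by
  set G := (galoisRepTorsion W ℓ).range.map Φ.toMonoidHom with hG
  have hGtop : G ≠ ⊤ := fun h ↦ hns ((map_range_galoisRepTorsion_eq_top_iff W ℓ Φ).mp h)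
  obtain ⟨c, hcG, hcc, hcdet⟩ := exists_conj_mem_map_range W ℓ Φ e he
  have hres : (∃ (v : Fin 2 → ZMod ℓ) (hv : v ≠ 0), G ≤ eigenvectorStabilizer v hv) ∨
      ∃ C ∈ cartanSubgroups (ZMod ℓ),
        G ≤ Subgroup.normalizer (C : Set (GL (Fin 2) (ZMod ℓ))) ∧ ¬ G ≤ C := by
    rcases hloc with ⟨P, hP⟩ | ⟨k, hk, h2, hkG⟩
    · exact borel_or_normalizer_of_halfSplitCartan_le G hℓ2 hℓ5 hP hGtop hcG hcc hcdet
    · exact borel_or_normalizer_of_unitGroup_le G hℓ2 hk h2 hkG hGtop hcG hcc hcdet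
  rcases hres with ⟨v, hv, hB⟩ | h
  · exact absurd hB
      (not_le_eigenvectorStabilizer_of_hasIrreducibleModPGaloisRep W ℓ Φ e he hirr hv)
  · exact h

end Frame

/-! ### The quadratic character of case ii): `U = ρ̄⁻¹(Φ⁻¹(C)) ≤ Γ_ℚ` -/

section Character

variable {C : Subgroup (GL (Fin 2) (ZMod ℓ))}

/-- Membership in `U = ρ̄⁻¹(Φ⁻¹(C))`: `σ ∈ U ↔ Φ(ρ̄ σ) ∈ C`. [folklore] -/
theorem mem_comap_cartan_iff {σ : absoluteGaloisGroup ℚ} :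
    σ ∈ (C.comap Φ.toMonoidHom).comap (galoisRepTorsion W ℓ) ↔ Φ (galoisRepTorsion W ℓ σ) ∈ C :=
  Iff.rfl

/-- **`[Γ_ℚ : U] = 2`** for `U = ρ̄⁻¹(Φ⁻¹(C))` when `G_ℓ ⊆ N(C)`, `G_ℓ ⊄ C` ("`ε_l : G → N_l/C_l`
… est un caractère d'ordre 2 de `G`; il correspond à une extension quadratique `K'_l` de `K`",
§4.2 c)): `(N : C) = 2` (n° 2.2, `relIndex_normalizer_eq_two`). [cite: Serre1972, §4.2 c)] -/
theorem index_comap_cartan_eq_two (hC : C ∈ cartanSubgroups (ZMod ℓ))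
    (hℓ : (∃ P : GL (Fin 2) (ZMod ℓ), C = splitCartan P) → ℓ ≠ 2)
    (hGN : (galoisRepTorsion W ℓ).range.map Φ.toMonoidHom ≤
      Subgroup.normalizer (C : Set (GL (Fin 2) (ZMod ℓ))))
    (hGC : ¬ (galoisRepTorsion W ℓ).range.map Φ.toMonoidHom ≤ C) :
    ((C.comap Φ.toMonoidHom).comap (galoisRepTorsion W ℓ)).index = 2 := by
  set N := Subgroup.normalizer (C : Set (GL (Fin 2) (ZMod ℓ))) with hN
  have h2 : (C.subgroupOf N).index = 2 := relIndex_normalizer_eq_two hC hℓ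
  -- an element of `G_ℓ` outside `C`
  obtain ⟨σ₀, hσ₀⟩ : ∃ σ₀ : absoluteGaloisGroup ℚ, Φ (galoisRepTorsion W ℓ σ₀) ∉ C := by
    by_contra! h
    exact hGC fun g hg ↦ by
      obtain ⟨σ, rfl⟩ := (mem_map_range_galoisRepTorsion_iff W ℓ Φ).mp hg
      exact h σ
  refine Subgroup.index_eq_two_iff.mpr ⟨σ₀, fun τ ↦ ?_⟩
  rw [mem_comap_cartan_iff, mem_comap_cartan_iff, map_mul, map_mul]
  set x : N := ⟨Φ (galoisRepTorsion W ℓ τ), hGN (apply_galoisRepTorsion_mem_map_range W ℓ Φ τ)⟩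
  set a : N := ⟨Φ (galoisRepTorsion W ℓ σ₀), hGN (apply_galoisRepTorsion_mem_map_range W ℓ Φ σ₀)⟩
  have key : (x * a : N).1 ∈ C ↔ ((x : N).1 ∈ C ↔ (a : N).1 ∈ C) := by
    have := Subgroup.mul_mem_iff_of_index_two h2 (a := x) (b := a)
    simpa only [Subgroup.mem_subgroupOf] using this
  change Xor ((x * a : N).1 ∈ C) ((x : N).1 ∈ C)
  rw [key]
  have ha : (a : N).1 ∉ C := hσ₀
  by_cases hx : (x : N).1 ∈ C
  · exact Or.inr ⟨hx, fun h ↦ ha (h.mp hx)⟩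
  · exact Or.inl ⟨⟨fun h ↦ absurd h hx, fun h ↦ absurd h ha⟩, hx⟩

/-- **`U = ρ̄⁻¹(Φ⁻¹(C))` is open in `Γ_ℚ`**: it contains the open kernel `Gal(ℚ̄/ℚ(E[ℓ]))` of
`ρ̄_{E,ℓ}` (`isOpen_ker_galoisRepTorsion_holds`), i.e. the quadratic character `ε_l` is
continuous. [cite: Serre1972, §4.2 c)] -/
theorem isOpen_comap_cartan [W.IsElliptic] :
    IsOpen (((C.comap Φ.toMonoidHom).comap (galoisRepTorsion W ℓ) :
      Subgroup (absoluteGaloisGroup ℚ)) : Set (absoluteGaloisGroup ℚ)) := by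
  refine Subgroup.isOpen_mono (H₁ := (galoisRepTorsion W ℓ).ker) (fun σ hσ ↦ ?_)
    (isOpen_ker_galoisRepTorsion_holds W (n := ℓ)
      (by exact_mod_cast (Fact.out : ℓ.Prime).ne_zero))
  rw [mem_comap_cartan_iff, MonoidHom.mem_ker.mp hσ, map_one]
  exact C.one_mem

/-- **Serre 1972, §4.2, Lemme 2 at the good places `v ∤ l`, over `ℚ`**: `U = ρ̄⁻¹(Φ⁻¹(C))`
contains the inertia group of every prime `𝔓` of `\bar ℤ` above a prime `p ≠ ℓ` of good
reduction ("si `v ∈ Σ` et si `p_v ≠ l`, `φ_l` est non ramifié en `v`; il en est a fortiori de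
même de `ε_l`"; the tree's `galoisRepTorsion_eq_one_of_mem_inertia_prime`, Silverman
VII.4.1). [cite: Serre1972, §4.2, Lemme 2] -/
theorem inertia_le_comap_cartan [W.IsElliptic] [W.IsGloballyMinimal] {p : ℕ} [Fact p.Prime]
    (hpℓ : p ≠ ℓ) (hgood : W.HasGoodReductionAtPrime p) {v : HeightOneSpectrum (𝓞 ℚ)}
    (hv : (primesEquiv v : ℕ) = p) {𝔓 : Ideal (absIntegers (𝓞 ℚ) ℚ)} (h𝔓 : 𝔓 ∈ v.primesAbove) :
    𝔓.inertia (absoluteGaloisGroup ℚ) ≤ (C.comap Φ.toMonoidHom).comap (galoisRepTorsion W ℓ) := by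
  intro τ hτ
  rw [mem_comap_cartan_iff, W.galoisRepTorsion_eq_one_of_mem_inertia_prime ℓ hpℓ hgood hv h𝔓 hτ,
    map_one]
  exact C.one_mem

/-- **Lemme 3 in terms of `U`** (link with `SerreOpenImageLemmeTroisProofs`): if
`G_ℓ ⊆ N(C)` and an arithmetic Frobenius `σ` at a prime `𝔓 ∣ p` (`p ≠ ℓ` of good reduction)
lies outside `U = ρ̄⁻¹(Φ⁻¹(C))` ("`v` inerte dans `K'_l`"), then `ℓ ∣ a_p` — for a
trace-compatible frame `Φ`. [cite: Serre1972, §4.2, proof of Lemme 3] -/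
theorem natCast_dvd_frobeniusTrace_of_not_mem_comap_cartan [W.IsElliptic] [W.IsGloballyMinimal]
    (hΦ : letI : Module (ZMod ℓ) (geomTorsion W ℓ) := AddSubgroup.torsionBy.zmodModule
      ∀ g : Multiplicative (AddAut (geomTorsion W ℓ)),
        Matrix.trace ((Φ g : GL (Fin 2) (ZMod ℓ)) : Matrix (Fin 2) (Fin 2) (ZMod ℓ)) =
          LinearMap.trace (ZMod ℓ) (geomTorsion W ℓ)
            ((Multiplicative.toAdd g).toAddMonoidHom.toZModLinearMap ℓ))
    (hC : C ∈ cartanSubgroups (ZMod ℓ))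
    (hℓ : (∃ P : GL (Fin 2) (ZMod ℓ), C = splitCartan P) → ℓ ≠ 2)
    (hGN : (galoisRepTorsion W ℓ).range.map Φ.toMonoidHom ≤
      Subgroup.normalizer (C : Set (GL (Fin 2) (ZMod ℓ))))
    {p : ℕ} [Fact p.Prime] (hpℓ : p ≠ ℓ) (hgood : W.HasGoodReductionAtPrime p)
    {v : HeightOneSpectrum (𝓞 ℚ)} (hv : (primesEquiv v : ℕ) = p)
    {𝔓 : Ideal (absIntegers (𝓞 ℚ) ℚ)} (h𝔓 : 𝔓 ∈ v.primesAbove)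
    {σ : absoluteGaloisGroup ℚ} (hσ : IsArithFrobAt (𝓞 ℚ) σ 𝔓)
    (hσU : σ ∉ (C.comap Φ.toMonoidHom).comap (galoisRepTorsion W ℓ)) :
    (ℓ : ℤ) ∣ W.frobeniusTrace p :=
  W.natCast_dvd_frobeniusTrace_of_frobenius_not_mem_cartan ℓ Φ hΦ hC hℓ hpℓ hgood hv h𝔓 hσ
    (hGN (apply_galoisRepTorsion_mem_map_range W ℓ Φ σ)) hσU

end Character

end WeierstrassCurve
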